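import Summits.CriticalPhenomena.PercolationContinuityZ3.Theorems.PercNearOneGluingNoHeavyLowerTailSahiLCExmaxRefutation
import Mathlib
import HarnessLib
import HarnessLib.Audit.Tags

/-!
# `NoHeavyLowerTail` (crux stmt-CriticalPhenomena-4575), master-family line P1 (gen 20):
# the GEOMETRIC-WEIGHT DICTIONARY — at the i.i.d. weights `(q³, q²p, qp², p³)` of a product measure the exchangeable-weight functionals
# `T, Φ_A, Φ_B` ARE `6e₃, 6κG, 6oG` (finite-sum form)

Support file (seat `prim-masterthm-p1`, gen 20; `--supports stmt-CriticalPhenomena-4575`), on top of `…SahiExchangeableLC` (gen 17: `tripleWeight`, `wRainbowSum`,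
`wSideSum`).  Memo `run/shared/lean/prim/prim-masterthm/FROM-prim-masterthm-p1-g20-ORBLOCK-AND-CERTIFICATES.md` §2.  Companion of `…SahiVertexPrinciple` (gen 20).

For a labeling `f : Finset ℕ → Lab k` of the subsets of `S` and a bias vector `p`, the product measure gives the point `x ⊆ S` the mass
`μ_p(x) = Π_{j∈S} (p_j if j ∈ x else 1−p_j)` (`ptMass`) and the label `a` the mass `m(a) = Σ_{x ⊆ S, f x = a} μ_p(x)` (`labMass`; `κ = m(A)`, `o = m(B)`,
`α_i = m(C_i)`).  The i.i.d. ("geometric") coordinate weight is `w_j(c) = p_j^c (1−p_j)^{3−c}` (`geomWt`).  THEOREMS (finite sums, any `k`):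
* `tripleWeight_geom`: `tripleWeight S (geomWt p) x y z = μ(x)μ(y)μ(z)` — three independent samples;
* `wRainbowSum_geom`: `T(geomWt p) = Σ_{i,j,l pairwise distinct} α_i α_j α_l` (`= 6·e₃(α)`; for `k = 3`, `6α₁α₂α₃`);
* `wSideSum_geom_top` / `_bot`: `Φ_A(geomWt p) = 3κ·(2κo − Σ_{i≠j} α_iα_j) = 6κ·G`, `Φ_B = 6o·G`, with `G = κo − e₂(α)` Gladkov's defect in these masses.
Hence every weight-level statement of the line specialises to the measure level: e.g. `T ≤ Φ_A + Φ_B` at `geomWt p` IS S₃⁺ `(κ+o)·G ≥ e₃`, `T ≤ max(Φ_A,Φ_B)` IS S₃^max,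
and (with `…SahiVertexPrinciple`) CP3⁺ at all vertex fibres of `f` gives S₃⁺ for `f` at every bias (`s3plus_of_cp3plus_geom` states the last step).
HONEST FRAMING: bookkeeping identities (the "gen 16 dictionary" made kernel-checkable); nothing conjectural is settled. [this work]
-/

namespace Summit.CriticalPhenomena.PercolationContinuityZ3.Theorems

namespace SahiPivotFamily

open Finset AntipodalStrongHarris AntipodalStrongHarris.Lab

variable {k : ℕ}

/-! ### 1. Point masses, label masses, geometric weights -/

/-- Mass of the point `x ⊆ S` under the product measure with biases `p`: `Π_{j∈S} (p_j if j ∈ x else 1 − p_j)`. [this work] -/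
def ptMass (S : Finset ℕ) (p : ℕ → ℝ) (x : Finset ℕ) : ℝ := ∏ j ∈ S, if j ∈ x then p j else 1 - p j

/-- Mass of a label: `Σ_{x ⊆ S, f x = a} μ_p(x)`. [this work] -/
def labMass (S : Finset ℕ) (p : ℕ → ℝ) (f : Finset ℕ → Lab k) (a : Lab k) : ℝ :=
  ∑ x ∈ S.powerset, if f x = a then ptMass S p x else 0

/-- The i.i.d. (geometric) exchangeable coordinate weight `w_j(c) = p_j^c (1 − p_j)^{3−c}`. [this work] -/
def geomWt (p : ℕ → ℝ) (j c : ℕ) : ℝ := p j ^ c * (1 - p j) ^ (3 - c)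

/-- **Three independent samples**: at geometric weights the triple weight factorises into the three point masses. [this work] -/
theorem tripleWeight_geom (S : Finset ℕ) (p : ℕ → ℝ) (x y z : Finset ℕ) :
    tripleWeight S (geomWt p) x y z = ptMass S p x * ptMass S p y * ptMass S p z := by
  unfold tripleWeight geomWt ptMass
  rw [← prod_mul_distrib, ← prod_mul_distrib]
  refine prod_congr rfl fun j _ => ?_
  by_cases hx : j ∈ x <;> by_cases hy : j ∈ y <;> by_cases hz : j ∈ z <;>
    simp only [hx, hy, hz, if_true, if_false, Nat.reduceAdd, Nat.reduceSub, add_zero, zero_add] <;> ring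

/-- Pulling a label indicator through the point-mass sum. [this work] -/
theorem sum_ptMass_ite (S : Finset ℕ) (p : ℕ → ℝ) (f : Finset ℕ → Lab k) (a : Lab k) (r : ℝ) :
    ∑ x ∈ S.powerset, ptMass S p x * (if f x = a then r else 0) = labMass S p f a * r := by
  unfold labMass
  rw [sum_mul]
  refine sum_congr rfl fun x _ => ?_
  split_ifs <;> ring

/-! ### 2. Summing a function of the label against the point masses -/

/-- **Label decomposition**: `Σ_z μ(z)·g(f z) = g(A)·κ + g(B)·o + Σ_l g(C_l)·α_l`. [this work] -/
theorem sum_ptMass_labFun (S : Finset ℕ) (p : ℕ → ℝ) (f : Finset ℕ → Lab k) (g : Lab k → ℝ) :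
    ∑ z ∈ S.powerset, ptMass S p z * g (f z) =
      g top * labMass S p f top + g bot * labMass S p f bot + ∑ l : Fin k, g (petal l) * labMass S p f (petal l) := by
  unfold labMass
  simp only [mul_sum, ← sum_add_distrib]
  rw [sum_comm, ← sum_add_distrib]
  refine sum_congr rfl fun z _ => ?_
  rcases hfz : f z with _ | l₀ | _
  · simp
    ring
  · rw [Finset.sum_eq_single l₀]
    · simp
      ring
    · intro l _ hl
      rw [if_neg (fun h => hl (petal.inj h).symm), mul_zero]
    · intro h; exact absurd (mem_univ l₀) h
  · simp
    ring

/-- Special case: `g` vanishing on the two polar labels sees only the petals. [this work] -/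
theorem sum_ptMass_petalFun (S : Finset ℕ) (p : ℕ → ℝ) (f : Finset ℕ → Lab k) (g : Lab k → ℝ) (h1 : g top = 0) (h0 : g bot = 0) :
    ∑ z ∈ S.powerset, ptMass S p z * g (f z) = ∑ l : Fin k, g (petal l) * labMass S p f (petal l) := by
  rw [sum_ptMass_labFun, h1, h0]; ring

/-! ### 3. `T`, `Φ_A`, `Φ_B` at geometric weights -/

/-- **`T` at geometric weights** = `Σ_{i,j,l} [C_i,C_j,C_l rainbow]·α_i α_j α_l` (`= 6·e₃(α)`: six orderings of each triple of distinct petals). [this work] -/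
theorem wRainbowSum_geom (S : Finset ℕ) (p : ℕ → ℝ) (f : Finset ℕ → Lab k) :
    wRainbowSum S (geomWt p) f =
      ∑ i : Fin k, ∑ j : Fin k, ∑ l : Fin k, (rainbow (petal i : Lab k) (petal j) (petal l) : ℝ) *
        (labMass S p f (petal i) * labMass S p f (petal j) * labMass S p f (petal l)) := by
  unfold wRainbowSum
  simp only [tripleWeight_geom]
  -- z-sum
  have hz : ∀ x y : Finset ℕ, ∑ z ∈ S.powerset, ptMass S p x * ptMass S p y * ptMass S p z * (rainbow (f x) (f y) (f z) : ℝ)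
      = ptMass S p x * (ptMass S p y * ∑ l : Fin k, (rainbow (f x) (f y) (petal l) : ℝ) * labMass S p f (petal l)) := by
    intro x y
    rw [← sum_ptMass_petalFun S p f (fun c => (rainbow (f x) (f y) c : ℝ))
      (by rcases f x with _ | i | _ <;> rcases f y with _ | j | _ <;> simp [rainbow])
      (by rcases f x with _ | i | _ <;> rcases f y with _ | j | _ <;> simp [rainbow]), mul_sum, mul_sum]
    refine sum_congr rfl fun z _ => ?_
    ring
  simp only [hz, ← mul_sum]
  -- y-sum
  have hy : ∀ x : Finset ℕ, ∑ y ∈ S.powerset, ptMass S p y * ∑ l : Fin k, (rainbow (f x) (f y) (petal l) : ℝ) * labMass S p f (petal l)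
      = ∑ j : Fin k, (∑ l : Fin k, (rainbow (f x) (petal j) (petal l) : ℝ) * labMass S p f (petal l)) * labMass S p f (petal j) := by
    intro x
    exact sum_ptMass_petalFun S p f (fun b => ∑ l : Fin k, (rainbow (f x) b (petal l) : ℝ) * labMass S p f (petal l))
      (by rcases f x with _ | i | _ <;> simp [rainbow]) (by rcases f x with _ | i | _ <;> simp [rainbow])
  simp only [hy]
  -- x-sum
  rw [sum_ptMass_petalFun S p f (fun a => ∑ j : Fin k, (∑ l : Fin k, (rainbow a (petal j) (petal l) : ℝ) * labMass S p f (petal l)) *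
      labMass S p f (petal j)) (by simp [rainbow]) (by simp [rainbow])]
  -- rearrange
  refine sum_congr rfl fun i _ => ?_
  rw [sum_mul]
  refine sum_congr rfl fun j _ => ?_
  rw [sum_mul, sum_mul]
  refine sum_congr rfl fun l _ => ?_
  ring

/-- The pair functional at geometric weights: `Σ_{y,z} μ(y)μ(z)·κ(f y, f z) = 2κo − Σ_{j≠l} α_j α_l` (`= 2·G`, twice Gladkov's defect). [this work] -/
theorem sum_ptMass_kappa (S : Finset ℕ) (p : ℕ → ℝ) (f : Finset ℕ → Lab k) :
    ∑ y ∈ S.powerset, ∑ z ∈ S.powerset, ptMass S p y * ptMass S p z * (kappa (f y) (f z) : ℝ) =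
      2 * labMass S p f top * labMass S p f bot -
        ∑ j : Fin k, ∑ l : Fin k, if j = l then 0 else labMass S p f (petal j) * labMass S p f (petal l) := by
  have hz : ∀ y : Finset ℕ, ∑ z ∈ S.powerset, ptMass S p y * ptMass S p z * (kappa (f y) (f z) : ℝ) =
      ptMass S p y * ((kappa (f y) top : ℝ) * labMass S p f top + (kappa (f y) bot : ℝ) * labMass S p f bot +
        ∑ l : Fin k, (kappa (f y) (petal l) : ℝ) * labMass S p f (petal l)) := by
    intro y
    rw [← sum_ptMass_labFun S p f (fun c => (kappa (f y) c : ℝ)), mul_sum]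
    refine sum_congr rfl fun z _ => ?_
    ring
  simp only [hz]
  rw [sum_ptMass_labFun S p f (fun b => (kappa b top : ℝ) * labMass S p f top + (kappa b bot : ℝ) * labMass S p f bot +
        ∑ l : Fin k, (kappa b (petal l) : ℝ) * labMass S p f (petal l))]
  simp only [kappa]
  push_cast
  simp only [zero_mul, zero_add, add_zero, one_mul, sum_const_zero]
  have hpet : ∀ j : Fin k, (∑ l : Fin k, (if j = l then (0 : ℝ) else -1) * labMass S p f (petal l)) * labMass S p f (petal j)
      = - ∑ l : Fin k, (if j = l then 0 else labMass S p f (petal j) * labMass S p f (petal l)) := by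
    intro j
    rw [sum_mul, ← sum_neg_distrib]
    refine sum_congr rfl fun l _ => ?_
    split_ifs <;> ring
  simp only [hpet, sum_neg_distrib]
  ring

/-- **`Φ_a` at geometric weights** = `3·m(a)·(2κo − Σ_{j≠l} α_jα_l)` (`= 6·m(a)·G`; `a = A`: `6κG`, `a = B`: `6oG`). [this work] -/
theorem wSideSum_geom (S : Finset ℕ) (p : ℕ → ℝ) (f : Finset ℕ → Lab k) (a : Lab k) :
    wSideSum S (geomWt p) f a = 3 * labMass S p f a *
      (2 * labMass S p f top * labMass S p f bot -
        ∑ j : Fin k, ∑ l : Fin k, if j = l then 0 else labMass S p f (petal j) * labMass S p f (petal l)) := by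
  unfold wSideSum
  simp only [tripleWeight_geom]
  rw [← sum_ptMass_kappa]
  have hx : ∀ x : Finset ℕ, (∑ y ∈ S.powerset, ∑ z ∈ S.powerset,
      if f x = a then ptMass S p x * ptMass S p y * ptMass S p z * (3 * (kappa (f y) (f z) : ℝ)) else 0)
      = ptMass S p x * (if f x = a then (3 : ℝ) else 0) *
          ∑ y ∈ S.powerset, ∑ z ∈ S.powerset, ptMass S p y * ptMass S p z * (kappa (f y) (f z) : ℝ) := by
    intro x
    rw [mul_sum]; refine sum_congr rfl fun y _ => ?_
    rw [mul_sum]; refine sum_congr rfl fun z _ => ?_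
    split_ifs <;> ring
  simp only [hx, ← sum_mul, sum_ptMass_ite]
  ring

/-! ### 4. The measure-level reading of CP3⁺ / of a one-payer certificate -/

/-- **S₃⁺ from CP3⁺ at the geometric weight.**  If `T ≤ Φ_A + Φ_B` at the weight `geomWt p`, then in the masses of `p`:
`Σ_{ijl} [rainbow] α_iα_jα_l ≤ 3(κ + o)(2κo − Σ_{j≠l} α_jα_l)`, i.e. `6e₃ ≤ 6(κ+o)G` (S₃⁺ for `f` at the bias `p`).  Combine with
`…SahiVertexPrinciple.cp3plus_allWeights_of_vertexCP3Plus` (geometric weights are nonnegative for `p ∈ [0,1]^S`, `geomWt_nonneg`) to get S₃⁺ for `f` at every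
bias from CP3⁺ at the vertex fibres of `f`. [this work] -/
theorem s3plus_of_cp3plus_geom (S : Finset ℕ) (p : ℕ → ℝ) (f : Finset ℕ → Lab k)
    (h : wRainbowSum S (geomWt p) f ≤ wSideSum S (geomWt p) f top + wSideSum S (geomWt p) f bot) :
    ∑ i : Fin k, ∑ j : Fin k, ∑ l : Fin k, (rainbow (petal i : Lab k) (petal j) (petal l) : ℝ) *
        (labMass S p f (petal i) * labMass S p f (petal j) * labMass S p f (petal l)) ≤
      3 * (labMass S p f top + labMass S p f bot) *
        (2 * labMass S p f top * labMass S p f bot -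
          ∑ j : Fin k, ∑ l : Fin k, if j = l then 0 else labMass S p f (petal j) * labMass S p f (petal l)) := by
  rw [wRainbowSum_geom, wSideSum_geom, wSideSum_geom] at h
  linarith

/-- Geometric weights are nonnegative for biases in `[0,1]`. [this work] -/
theorem geomWt_nonneg (p : ℕ → ℝ) (hp : ∀ j, 0 ≤ p j ∧ p j ≤ 1) (j c : ℕ) : 0 ≤ geomWt p j c := by
  unfold geomWt
  exact mul_nonneg (pow_nonneg (hp j).1 _) (pow_nonneg (by linarith [(hp j).2]) _)

/-- Geometric weights are casts of… (no: they are real) — the weight-level functionals at `geomWt p` coincide with the `ℝ`-valued ones used by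
`…SahiExchangeableLC`; this lemma records that `geomWt p j` is log-concave with equality (the i.i.d. case of gen 17's `LogConcaveWt`). [this work] -/
theorem logConcaveWt_geom (p : ℕ → ℝ) (hp : ∀ j, 0 ≤ p j ∧ p j ≤ 1) (j : ℕ) : LogConcaveWt (geomWt p j) := by
  refine ⟨fun c => geomWt_nonneg p hp j c, ?_, ?_⟩ <;> simp only [geomWt] <;> norm_num <;> nlinarith [(hp j).1, (hp j).2]

/-- **One payer at the geometric weight, in masses**: `T ≤ Φ_a` at `geomWt p` reads `Σ[rainbow]α_iα_jα_l ≤ 3·m(a)·(2κo − Σ_{j≠l}α_jα_l)`, i.e. `6e₃ ≤ 6·m(a)·G`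
(`a = A`: the core pays, `e₃ ≤ κG`; `a = B`: the outside pays, `e₃ ≤ oG`).  With `…SahiVertexPrinciple.corePays_weights_of_vertices` this is the measure-level content of a
vertex certificate: an A-uniform (resp. B-uniform) system satisfies S₃^max at every bias. [this work] -/
theorem onePayer_of_geom (S : Finset ℕ) (p : ℕ → ℝ) (f : Finset ℕ → Lab k) (a : Lab k)
    (h : wRainbowSum S (geomWt p) f ≤ wSideSum S (geomWt p) f a) :
    ∑ i : Fin k, ∑ j : Fin k, ∑ l : Fin k, (rainbow (petal i : Lab k) (petal j) (petal l) : ℝ) *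
        (labMass S p f (petal i) * labMass S p f (petal j) * labMass S p f (petal l)) ≤
      3 * labMass S p f a *
        (2 * labMass S p f top * labMass S p f bot -
          ∑ j : Fin k, ∑ l : Fin k, if j = l then 0 else labMass S p f (petal j) * labMass S p f (petal l)) := by
  rw [wRainbowSum_geom, wSideSum_geom] at h
  exact h

end SahiPivotFamily

end Summit.CriticalPhenomena.PercolationContinuityZ3.Theorems
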